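import Mathlib.Analysis.Calculus.SmoothSeries
import Mathlib.Analysis.Calculus.IteratedDeriv.Lemmas
import Literature.NumberTheory.LFunctions.WeilCriterionConverse
import Literature.NumberTheory.LFunctions.WeilExplicitFormulaProofs
import HarnessLib

/-!
# Stub `stub_definitize` (line `cofinite-weil-index-staircase`, crux `RuelleBand.CofiniteCriticalLine`) —
auxiliary file: the translation kernel of a test function on the ZERO SIDE

Helpers for `Summits/RiemannHypothesis/RiemannHypothesis/Theorems/RuelleBandCofiniteCriticalLineStubDefinitize.lean`
(item stmt-RiemannHypothesis-2064, `--supports`).  Normalisation of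
`Literature/NumberTheory/LFunctions/WeilExplicit.lean`: `Q = weilQuadratic`, `W = weilFunctional`,
`ĝ = weilMellin g`, `P_g(ρ) = ĝ(ρ) conj ĝ(1 - ρ̄) = WeilConverse.pairCoeff g ρ`,
`B_g(x) = Σ_ρ m(ρ) P_g(ρ) e^{(ρ-1/2)x} = WeilConverse.expSum g x`.

What is proved (all unconditional, sorry-free):

* finite sums `Σ cᵢ gᵢ` of test functions are test functions and `weilMellin` is linear over them
  (`stub_definitize_isWeilTest_finset_sum`, `stub_definitize_weilMellin_finset_sum`);
  `(f^{(j)})^(s) = (-(s-1/2))^j f̂(s)` (`stub_definitize_weilMellin_iteratedDeriv`);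
* `Q(g) = Σ_ρ m(ρ) P_g(ρ)` for test `g` (`stub_definitize_weilQuadratic_eq_zeroForm`: the explicit
  formula `explicit_formula_holds` and the absolute convergence `hasWeilZeroSide_zeroForm` describe
  the same symmetric limit);
* the ORBIT FORMULA `Q(Σ_k c_k g(· - x_k)) = Σ_{k,l} c_k c̄_l B_g(x_k - x_l)`
  (`stub_definitize_weilQuadratic_sum_translate`): the Gram matrix of `Re Q` on translates of `g`
  is the Toeplitz matrix of the kernel `B_g`;
* `B_g` is Hermitian, `B_g(-x) = conj B_g(x)`, smooth, and
  `B_g^{(r)}(x) = Σ_ρ m(ρ) P_g(ρ) (ρ-1/2)^r e^{(ρ-1/2)x}` (termwise differentiation; the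
  coefficients decay faster than any power of the ordinate because `g` is smooth);
* (in the sibling file `…StubDefinitizeAux2.lean`) the dictionary for `h = Σ_{j ≤ d} b_j (-1)^j f^{(j)}`:
  `B_h = Σ_{j,m ≤ d} b_j conj(b_m) (-1)^m B_f^{(j+m)}`, common windows for translates, and the
  passage from a uniform window-index bound to "`B_f` has at most `N` negative squares".
-/

set_option linter.dupNamespace false

noncomputable section

open Complex MeasureTheory Filter Set
open scoped BigOperators Topology ComplexConjugate

namespace Summit.RiemannHypothesis.RiemannHypothesis.Theorems.RuelleBandCofiniteCriticalLine

open Literature.NumberTheory.LFunctions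

/-! ### Finite sums of test functions -/

/-- A finite linear combination of test functions is a test function. [folklore] -/
theorem stub_definitize_isWeilTest_finset_sum {ι : Type*} (s : Finset ι) (c : ι → ℂ)
    {g : ι → ℝ → ℂ} (hg : ∀ i ∈ s, IsWeilTest (g i)) :
    IsWeilTest (fun t => ∑ i ∈ s, c i * g i t) := by
  refine ⟨ContDiff.sum fun i hi => contDiff_const.mul (hg i hi).1, ?_⟩
  refine HasCompactSupport.of_support_subset_isCompact
    (s.isCompact_biUnion fun i hi => (hg i hi).2.isCompact) fun t ht => ?_
  obtain ⟨i, hi, hne⟩ := Finset.exists_ne_zero_of_sum_ne_zero ht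
  exact Set.mem_biUnion hi (subset_tsupport _ (right_ne_zero_of_mul hne))

/-- `weilMellin` is linear over finite sums of continuous compactly supported functions:
`(Σ cᵢ gᵢ)^(s) = Σ cᵢ ĝᵢ(s)`. [folklore] -/
theorem stub_definitize_weilMellin_finset_sum {ι : Type*} (s : Finset ι) (c : ι → ℂ)
    {g : ι → ℝ → ℂ} (hg : ∀ i ∈ s, IsWeilTest (g i)) (z : ℂ) :
    weilMellin (fun t => ∑ i ∈ s, c i * g i t) z = ∑ i ∈ s, c i * weilMellin (g i) z := by
  unfold weilMellin
  simp_rw [Finset.sum_mul]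
  rw [integral_finsetSum _ fun i hi => ?_]
  · refine Finset.sum_congr rfl fun i _ => ?_
    rw [← integral_const_mul]
    congr 1 with t
    ring
  · have h := (integrable_weilIntegrand (hg i hi).1.continuous (hg i hi).2 z).const_mul (c i)
    refine h.congr (Eventually.of_forall fun t => ?_)
    ring

/-- Iterated derivatives of test functions are test functions. [folklore] -/
theorem stub_definitize_isWeilTest_iteratedDeriv {f : ℝ → ℂ} (hf : IsWeilTest f) :
    ∀ j : ℕ, IsWeilTest (iteratedDeriv j f)
  | 0 => by simpa using hf
  | j + 1 => by
    rw [iteratedDeriv_succ]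
    exact (stub_definitize_isWeilTest_iteratedDeriv hf j).deriv

/-- `(f^{(j)})^(s) = (-(s - 1/2))^j f̂(s)` (integration by parts `j` times, `weilMellin_deriv`).
[folklore] -/
theorem stub_definitize_weilMellin_iteratedDeriv {f : ℝ → ℂ} (hf : IsWeilTest f) (z : ℂ) :
    ∀ j : ℕ, weilMellin (iteratedDeriv j f) z = (-(z - 1 / 2)) ^ j * weilMellin f z
  | 0 => by simp
  | j + 1 => by
    rw [iteratedDeriv_succ, weilMellin_deriv (stub_definitize_isWeilTest_iteratedDeriv hf j),
      stub_definitize_weilMellin_iteratedDeriv hf z j, pow_succ]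
    ring

/-- The translate `t ↦ f(t - x)` has transform `e^{(s-1/2)x} f̂(s)` (`weilMellin_weilTranslate`).
[folklore] -/
theorem stub_definitize_weilMellin_translate (f : ℝ → ℂ) (x : ℝ) (z : ℂ) :
    weilMellin (fun t => f (t - x)) z = cexp ((z - 1 / 2) * x) * weilMellin f z :=
  weilMellin_weilTranslate f x z

/-! ### The zero side: `Q = zeroForm` on test functions, pair coefficients of translates -/

/-- **`Q(g) = Σ_ρ m(ρ) P_g(ρ)` for a test function `g`.** The symmetric zero sums of `g ⋆ g̃`
converge to `W(g ⋆ g̃) = Q(g)` (the explicit formula, `explicit_formula_holds`) and to the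
absolutely convergent sum `zeroForm g` (`WeilConverse.hasWeilZeroSide_zeroForm`); limits are
unique. [cite: Bombieri2000Weil, §2 Thm. 2 and §3] -/
theorem stub_definitize_weilQuadratic_eq_zeroForm {g : ℝ → ℂ} (hg : IsWeilTest g) :
    weilQuadratic g = WeilConverse.zeroForm g :=
  tendsto_nhds_unique (explicit_formula_holds (hg.weilConv hg.weilReflect))
    (WeilConverse.hasWeilZeroSide_zeroForm hg)

/-- For real `x`: `conj e^{(1 - ρ̄ - 1/2) x} = e^{(1/2 - ρ) x}`. [folklore] -/
theorem stub_definitize_conj_cexp_reflect (ρ : ℂ) (x : ℝ) :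
    conj (cexp ((1 - conj ρ - 1 / 2) * x)) = cexp ((1 / 2 - ρ) * x) := by
  rw [← Complex.exp_conj]
  congr 1
  simp only [map_mul, map_sub, map_one, map_div₀, map_ofNat, Complex.conj_conj,
    Complex.conj_ofReal]
  ring

/-- Transform of a sum of translates: `(Σ_k c_k g(· - x_k))^(s) = (Σ_k c_k e^{(s-1/2)x_k}) ĝ(s)`.
[folklore] -/
theorem stub_definitize_weilMellin_sum_translate {g : ℝ → ℂ} (hg : IsWeilTest g) {n : ℕ}
    (x : Fin n → ℝ) (c : Fin n → ℂ) (z : ℂ) :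
    weilMellin (fun t => ∑ k, c k * g (t - x k)) z =
      (∑ k, c k * cexp ((z - 1 / 2) * x k)) * weilMellin g z := by
  rw [stub_definitize_weilMellin_finset_sum (g := fun k t => g (t - x k)) _ _
    (fun k _ => hg.weilTranslate (x k)), Finset.sum_mul]
  refine Finset.sum_congr rfl fun k _ => ?_
  rw [stub_definitize_weilMellin_translate, mul_assoc]

/-- **Pair coefficient of a sum of translates**:
`P_{Σ_k c_k g(· - x_k)}(ρ) = (Σ_{k,l} c_k c̄_l e^{(ρ-1/2)(x_k - x_l)}) · P_g(ρ)` (the cross factor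
`e^{(ρ-1/2)x_k} conj e^{(1/2-ρ̄)x_l} = e^{(ρ-1/2)(x_k-x_l)}` because the `x`'s are real).
[folklore] -/
theorem stub_definitize_pairCoeff_sum_translate {g : ℝ → ℂ} (hg : IsWeilTest g) {n : ℕ}
    (x : Fin n → ℝ) (c : Fin n → ℂ) (ρ : ℂ) :
    WeilConverse.pairCoeff (fun t => ∑ k, c k * g (t - x k)) ρ =
      (∑ k, ∑ l, c k * conj (c l) * cexp ((ρ - 1 / 2) * (x k - x l : ℝ))) *
        WeilConverse.pairCoeff g ρ := by
  have hρ : ∀ k l : Fin n, cexp ((ρ - 1 / 2) * (x k - x l : ℝ)) =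
      cexp ((ρ - 1 / 2) * x k) * cexp ((1 / 2 - ρ) * x l) := by
    intro k l
    rw [← Complex.exp_add]
    congr 1
    push_cast
    ring
  have hAB : (∑ k, c k * cexp ((ρ - 1 / 2) * x k)) *
      conj (∑ l, c l * cexp ((1 - conj ρ - 1 / 2) * x l)) =
      ∑ k, ∑ l, c k * conj (c l) * cexp ((ρ - 1 / 2) * (x k - x l : ℝ)) := by
    rw [map_sum, Finset.sum_mul_sum]
    refine Finset.sum_congr rfl fun k _ => Finset.sum_congr rfl fun l _ => ?_
    rw [map_mul, stub_definitize_conj_cexp_reflect, hρ]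
    ring
  rw [WeilConverse.pairCoeff, WeilConverse.pairCoeff, stub_definitize_weilMellin_sum_translate hg,
    stub_definitize_weilMellin_sum_translate hg, map_mul, ← hAB]
  ring

/-- **Orbit formula on the zero side**: for a test function `g`, points `x_k` and coefficients
`c_k`, `Q(Σ_k c_k g(· - x_k)) = Σ_k Σ_l c_k c̄_l B_g(x_k - x_l)` with
`B_g = WeilConverse.expSum g`: the Gram matrix of Weil's form on the translates of `g` is the
Toeplitz matrix of the kernel `B_g`. [folklore] -/
theorem stub_definitize_weilQuadratic_sum_translate {g : ℝ → ℂ} (hg : IsWeilTest g) {n : ℕ}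
    (x : Fin n → ℝ) (c : Fin n → ℂ) :
    weilQuadratic (fun t => ∑ k, c k * g (t - x k)) =
      ∑ k, ∑ l, c k * conj (c l) * WeilConverse.expSum g (x k - x l) := by
  have hG : IsWeilTest (fun t => ∑ k, c k * g (t - x k)) :=
    stub_definitize_isWeilTest_finset_sum (g := fun k t => g (t - x k)) _ _
      fun k _ => hg.weilTranslate (x k)
  rw [stub_definitize_weilQuadratic_eq_zeroForm hG, WeilConverse.zeroForm]
  simp_rw [stub_definitize_pairCoeff_sum_translate hg, WeilConverse.expSum]
  have hS : ∀ k l : Fin n, Summable fun ρ : ZetaZeros.riemannZetaNontrivialZeros =>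
      (riemannZetaZeroOrder (ρ : ℂ) : ℂ) * WeilConverse.pairCoeff g ρ *
        cexp (((ρ : ℂ) - 1 / 2) * (x k - x l : ℝ)) :=
    fun k l => WeilConverse.summable_expSum hg (x k - x l)
  calc ∑' ρ : ZetaZeros.riemannZetaNontrivialZeros, (riemannZetaZeroOrder (ρ : ℂ) : ℂ) *
        ((∑ k, ∑ l, c k * conj (c l) * cexp (((ρ : ℂ) - 1 / 2) * (x k - x l : ℝ))) *
          WeilConverse.pairCoeff g ρ)
      = ∑' ρ : ZetaZeros.riemannZetaNontrivialZeros, ∑ k, ∑ l, c k * conj (c l) *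
          ((riemannZetaZeroOrder (ρ : ℂ) : ℂ) * WeilConverse.pairCoeff g ρ *
            cexp (((ρ : ℂ) - 1 / 2) * (x k - x l : ℝ))) := by
        refine tsum_congr fun ρ => ?_
        rw [Finset.sum_mul, Finset.mul_sum]
        refine Finset.sum_congr rfl fun k _ => ?_
        rw [Finset.sum_mul, Finset.mul_sum]
        refine Finset.sum_congr rfl fun l _ => ?_
        ring
    _ = ∑ k, ∑' ρ : ZetaZeros.riemannZetaNontrivialZeros, ∑ l, c k * conj (c l) *
          ((riemannZetaZeroOrder (ρ : ℂ) : ℂ) * WeilConverse.pairCoeff g ρ *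
            cexp (((ρ : ℂ) - 1 / 2) * (x k - x l : ℝ))) :=
        Summable.tsum_finsetSum fun k _ => summable_sum fun l _ => (hS k l).mul_left _
    _ = ∑ k, ∑ l, ∑' ρ : ZetaZeros.riemannZetaNontrivialZeros, c k * conj (c l) *
          ((riemannZetaZeroOrder (ρ : ℂ) : ℂ) * WeilConverse.pairCoeff g ρ *
            cexp (((ρ : ℂ) - 1 / 2) * (x k - x l : ℝ))) :=
        Finset.sum_congr rfl fun k _ => Summable.tsum_finsetSum fun l _ => (hS k l).mul_left _
    _ = ∑ k, ∑ l, c k * conj (c l) * ∑' ρ : ZetaZeros.riemannZetaNontrivialZeros,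
          (riemannZetaZeroOrder (ρ : ℂ) : ℂ) * WeilConverse.pairCoeff g ρ *
            cexp (((ρ : ℂ) - 1 / 2) * (x k - x l : ℝ)) := by
        simp_rw [tsum_mul_left]

/-! ### The kernel `B_g = expSum g`: Hermitian symmetry, decay of coefficients, derivatives -/

/-- **Hermitian symmetry of the kernel**: `B_g(-x) = conj B_g(x)` (`B_g(-x) = A_g(x)` termwise and
`conj A_g = B_g`, `WeilConverse.conj_expSum'`). [folklore] -/
theorem stub_definitize_expSum_neg (g : ℝ → ℂ) (x : ℝ) :
    WeilConverse.expSum g (-x) = conj (WeilConverse.expSum g x) := by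
  rw [← WeilConverse.conj_expSum' g x, Complex.conj_conj, WeilConverse.expSum, WeilConverse.expSum']
  refine tsum_congr fun ρ => ?_
  congr 2
  push_cast
  ring

/-- **Decay of the weighted pair coefficients**: for a test function `f`, `r : ℕ` and a
non-trivial zero `ρ = β + iγ`,
`‖P_f(ρ) (ρ - 1/2)^r‖ ≤ C(f^{(r)}) C(f) / (1 + γ²)²` (`(ρ-1/2)^r f̂(ρ) = ± (f^{(r)})^(ρ)` and
`norm_weilMellin_le` for `f^{(r)}` and for `f` at `1 - ρ̄`). [folklore] -/
theorem stub_definitize_norm_pairCoeff_mul_pow_le {f : ℝ → ℂ} (hf : IsWeilTest f) (r : ℕ) {ρ : ℂ}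
    (hρ : ρ ∈ ZetaZeros.riemannZetaNontrivialZeros) :
    ‖WeilConverse.pairCoeff f ρ * (ρ - 1 / 2) ^ r‖ ≤
      weilDecayConst (iteratedDeriv r f) * weilDecayConst f / (1 + ρ.im ^ 2) ^ 2 := by
  have h0 := ZetaZeros.riemannZetaNontrivialZeros.re_pos hρ
  have h1 := ZetaZeros.riemannZetaNontrivialZeros.re_lt_one hρ
  have hA : ‖(ρ - 1 / 2) ^ r * weilMellin f ρ‖ ≤
      weilDecayConst (iteratedDeriv r f) / (1 + ρ.im ^ 2) := by
    have h := norm_weilMellin_le (stub_definitize_isWeilTest_iteratedDeriv hf r) (s := ρ) h0.le h1.le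
    rw [stub_definitize_weilMellin_iteratedDeriv hf ρ r, norm_mul, norm_pow, norm_neg] at h
    rwa [norm_mul, norm_pow]
  have hB : ‖weilMellin f (1 - conj ρ)‖ ≤ weilDecayConst f / (1 + ρ.im ^ 2) := by
    have := norm_weilMellin_le hf (s := 1 - conj ρ)
      (by rw [WeilConverse.one_sub_conj_re]; linarith)
      (by rw [WeilConverse.one_sub_conj_re]; linarith)
    rwa [WeilConverse.one_sub_conj_im] at this
  have hA0 : 0 ≤ weilDecayConst (iteratedDeriv r f) / (1 + ρ.im ^ 2) :=
    div_nonneg (weilDecayConst_nonneg _) (by positivity)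
  calc ‖WeilConverse.pairCoeff f ρ * (ρ - 1 / 2) ^ r‖
      = ‖(ρ - 1 / 2) ^ r * weilMellin f ρ‖ * ‖weilMellin f (1 - conj ρ)‖ := by
        rw [WeilConverse.pairCoeff, ← Complex.norm_conj (weilMellin f (1 - conj ρ)), ← norm_mul]
        congr 1
        ring
    _ ≤ (weilDecayConst (iteratedDeriv r f) / (1 + ρ.im ^ 2)) *
          (weilDecayConst f / (1 + ρ.im ^ 2)) :=
        mul_le_mul hA hB (norm_nonneg _) hA0
    _ = weilDecayConst (iteratedDeriv r f) * weilDecayConst f / (1 + ρ.im ^ 2) ^ 2 := by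
        rw [div_mul_div_comm, ← pow_two]

/-- Summability of the termwise derivatives of `B_f`, with the uniform majorant used on `|x| ≤ R`:
the family `ρ ↦ m(ρ) · C(f^{(r)}) C(f) e^{R/2} / (1 + γ²)²` is summable. [folklore] -/
theorem stub_definitize_summable_majorant (f : ℝ → ℂ) (r : ℕ) (R : ℝ) :
    Summable fun ρ : ZetaZeros.riemannZetaNontrivialZeros =>
      ‖(riemannZetaZeroOrder (ρ : ℂ) : ℂ) *
        ((weilDecayConst (iteratedDeriv r f) * weilDecayConst f * Real.exp (R / 2) /
          (1 + (ρ : ℂ).im ^ 2) ^ 2 : ℝ) : ℂ)‖ := by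
  refine summable_norm_zeroSide_of_le
    (a := fun ρ : ℂ => ((weilDecayConst (iteratedDeriv r f) * weilDecayConst f * Real.exp (R / 2) /
      (1 + ρ.im ^ 2) ^ 2 : ℝ) : ℂ))
    (K := weilDecayConst (iteratedDeriv r f) * weilDecayConst f * Real.exp (R / 2)) fun ρ _ => ?_
  rw [Complex.norm_real, Real.norm_eq_abs, abs_of_nonneg]
  exact div_nonneg (mul_nonneg (mul_nonneg (weilDecayConst_nonneg _) (weilDecayConst_nonneg _))
    (Real.exp_pos _).le) (by positivity)

/-- The termwise bound on `|x| ≤ R`: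
`‖m(ρ) P_f(ρ) (ρ-1/2)^r e^{(ρ-1/2)x}‖ ≤ ‖m(ρ) · C(f^{(r)}) C(f) e^{R/2}/(1+γ²)²‖`. [folklore] -/
theorem stub_definitize_norm_term_le {f : ℝ → ℂ} (hf : IsWeilTest f) (r : ℕ) {R x : ℝ}
    (hx : |x| ≤ R) (ρ : ZetaZeros.riemannZetaNontrivialZeros) :
    ‖(riemannZetaZeroOrder (ρ : ℂ) : ℂ) * WeilConverse.pairCoeff f ρ * ((ρ : ℂ) - 1 / 2) ^ r *
        cexp (((ρ : ℂ) - 1 / 2) * x)‖ ≤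
      ‖(riemannZetaZeroOrder (ρ : ℂ) : ℂ) *
        ((weilDecayConst (iteratedDeriv r f) * weilDecayConst f * Real.exp (R / 2) /
          (1 + (ρ : ℂ).im ^ 2) ^ 2 : ℝ) : ℂ)‖ := by
  have hK0 : 0 ≤ weilDecayConst (iteratedDeriv r f) * weilDecayConst f * Real.exp (R / 2) /
      (1 + (ρ : ℂ).im ^ 2) ^ 2 :=
    div_nonneg (mul_nonneg (mul_nonneg (weilDecayConst_nonneg _) (weilDecayConst_nonneg _))
      (Real.exp_pos _).le) (by positivity)
  have hC0 : 0 ≤ weilDecayConst (iteratedDeriv r f) * weilDecayConst f / (1 + (ρ : ℂ).im ^ 2) ^ 2 :=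
    div_nonneg (mul_nonneg (weilDecayConst_nonneg _) (weilDecayConst_nonneg _)) (by positivity)
  have hE : ‖cexp (((ρ : ℂ) - 1 / 2) * x)‖ ≤ Real.exp (R / 2) :=
    (WeilConverse.norm_cexp_mul_real_le (WeilConverse.abs_re_sub_half_le ρ.2) x).trans
      (Real.exp_le_exp.2 (by linarith))
  calc ‖(riemannZetaZeroOrder (ρ : ℂ) : ℂ) * WeilConverse.pairCoeff f ρ * ((ρ : ℂ) - 1 / 2) ^ r *
        cexp (((ρ : ℂ) - 1 / 2) * x)‖
      = ‖(riemannZetaZeroOrder (ρ : ℂ) : ℂ)‖ *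
          (‖WeilConverse.pairCoeff f ρ * ((ρ : ℂ) - 1 / 2) ^ r‖ * ‖cexp (((ρ : ℂ) - 1 / 2) * x)‖) := by
        rw [← norm_mul, ← norm_mul]
        congr 1
        ring
    _ ≤ ‖(riemannZetaZeroOrder (ρ : ℂ) : ℂ)‖ *
          ((weilDecayConst (iteratedDeriv r f) * weilDecayConst f / (1 + (ρ : ℂ).im ^ 2) ^ 2) *
            Real.exp (R / 2)) :=
        mul_le_mul_of_nonneg_left (mul_le_mul (stub_definitize_norm_pairCoeff_mul_pow_le hf r ρ.2)
          hE (norm_nonneg _) hC0) (norm_nonneg _)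
    _ = ‖(riemannZetaZeroOrder (ρ : ℂ) : ℂ) *
        ((weilDecayConst (iteratedDeriv r f) * weilDecayConst f * Real.exp (R / 2) /
          (1 + (ρ : ℂ).im ^ 2) ^ 2 : ℝ) : ℂ)‖ := by
        rw [norm_mul, Complex.norm_real, Real.norm_eq_abs, abs_of_nonneg hK0]
        ring

/-- The derived series `Σ_ρ m(ρ) P_f(ρ) (ρ-1/2)^r e^{(ρ-1/2)x}` converges absolutely for every
real `x`. [folklore] -/
theorem stub_definitize_summable_term {f : ℝ → ℂ} (hf : IsWeilTest f) (r : ℕ) (x : ℝ) :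
    Summable fun ρ : ZetaZeros.riemannZetaNontrivialZeros =>
      (riemannZetaZeroOrder (ρ : ℂ) : ℂ) * WeilConverse.pairCoeff f ρ * ((ρ : ℂ) - 1 / 2) ^ r *
        cexp (((ρ : ℂ) - 1 / 2) * x) :=
  .of_norm_bounded (stub_definitize_summable_majorant f r |x|)
    (stub_definitize_norm_term_le hf r le_rfl)

/-- `d/dt e^{wt} = w e^{wt}` along the real line. [folklore] -/
theorem stub_definitize_hasDerivAt_cexp (w : ℂ) (t : ℝ) :
    HasDerivAt (fun t : ℝ => cexp (w * t)) (w * cexp (w * t)) t := by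
  have h1 : HasDerivAt (fun t : ℝ => w * (t : ℂ)) (w * 1) t :=
    (Complex.ofRealCLM.hasDerivAt.const_mul w).congr_deriv (by simp)
  have h2 := (Complex.hasDerivAt_exp (w * t)).comp t h1
  simpa [mul_comm, Function.comp_def] using h2

/-- **Termwise differentiation of the kernel series**: for every `r` and real `y`,
`d/dy Σ_ρ m(ρ) P_f(ρ) (ρ-1/2)^r e^{(ρ-1/2)y} = Σ_ρ m(ρ) P_f(ρ) (ρ-1/2)^{r+1} e^{(ρ-1/2)y}`
(`hasDerivAt_tsum_of_isPreconnected` on the ball `|y| < R` with the majorant of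
`stub_definitize_summable_majorant`). [folklore] -/
theorem stub_definitize_hasDerivAt_series {f : ℝ → ℂ} (hf : IsWeilTest f) (r : ℕ) (y : ℝ) :
    HasDerivAt (fun z : ℝ => ∑' ρ : ZetaZeros.riemannZetaNontrivialZeros,
        (riemannZetaZeroOrder (ρ : ℂ) : ℂ) * WeilConverse.pairCoeff f ρ * ((ρ : ℂ) - 1 / 2) ^ r *
          cexp (((ρ : ℂ) - 1 / 2) * z))
      (∑' ρ : ZetaZeros.riemannZetaNontrivialZeros,
        (riemannZetaZeroOrder (ρ : ℂ) : ℂ) * WeilConverse.pairCoeff f ρ *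
          ((ρ : ℂ) - 1 / 2) ^ (r + 1) * cexp (((ρ : ℂ) - 1 / 2) * y)) y := by
  have hyR : y ∈ Metric.ball (0 : ℝ) (|y| + 1) := by
    rw [Metric.mem_ball, dist_zero_right, Real.norm_eq_abs]
    exact lt_add_one _
  have h0R : (0 : ℝ) ∈ Metric.ball (0 : ℝ) (|y| + 1) := Metric.mem_ball_self (by positivity)
  have hderiv : ∀ (ρ : ZetaZeros.riemannZetaNontrivialZeros) (z : ℝ), z ∈ Metric.ball (0 : ℝ) (|y| + 1) →
      HasDerivAt (fun z : ℝ => (riemannZetaZeroOrder (ρ : ℂ) : ℂ) * WeilConverse.pairCoeff f ρ *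
          ((ρ : ℂ) - 1 / 2) ^ r * cexp (((ρ : ℂ) - 1 / 2) * z))
        ((riemannZetaZeroOrder (ρ : ℂ) : ℂ) * WeilConverse.pairCoeff f ρ *
          ((ρ : ℂ) - 1 / 2) ^ (r + 1) * cexp (((ρ : ℂ) - 1 / 2) * z)) z := by
    intro ρ z _
    have h := (stub_definitize_hasDerivAt_cexp (((ρ : ℂ) - 1 / 2)) z).const_mul
      ((riemannZetaZeroOrder (ρ : ℂ) : ℂ) * WeilConverse.pairCoeff f ρ * ((ρ : ℂ) - 1 / 2) ^ r)
    have e : (riemannZetaZeroOrder (ρ : ℂ) : ℂ) * WeilConverse.pairCoeff f ρ * ((ρ : ℂ) - 1 / 2) ^ r *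
        (((ρ : ℂ) - 1 / 2) * cexp (((ρ : ℂ) - 1 / 2) * z)) =
        (riemannZetaZeroOrder (ρ : ℂ) : ℂ) * WeilConverse.pairCoeff f ρ *
          ((ρ : ℂ) - 1 / 2) ^ (r + 1) * cexp (((ρ : ℂ) - 1 / 2) * z) := by
      rw [pow_succ]
      ring
    rw [e] at h
    exact h
  have hbound : ∀ (ρ : ZetaZeros.riemannZetaNontrivialZeros) (z : ℝ), z ∈ Metric.ball (0 : ℝ) (|y| + 1) →
      ‖(riemannZetaZeroOrder (ρ : ℂ) : ℂ) * WeilConverse.pairCoeff f ρ *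
          ((ρ : ℂ) - 1 / 2) ^ (r + 1) * cexp (((ρ : ℂ) - 1 / 2) * z)‖ ≤
        ‖(riemannZetaZeroOrder (ρ : ℂ) : ℂ) *
          ((weilDecayConst (iteratedDeriv (r + 1) f) * weilDecayConst f * Real.exp ((|y| + 1) / 2) /
            (1 + (ρ : ℂ).im ^ 2) ^ 2 : ℝ) : ℂ)‖ := by
    intro ρ z hz
    refine stub_definitize_norm_term_le hf (r + 1) ?_ ρ
    rw [Metric.mem_ball, dist_zero_right, Real.norm_eq_abs] at hz
    exact hz.le
  exact hasDerivAt_tsum_of_isPreconnected (stub_definitize_summable_majorant f (r + 1) (|y| + 1))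
    Metric.isOpen_ball (convex_ball (0 : ℝ) (|y| + 1)).isPreconnected hderiv hbound h0R
    (stub_definitize_summable_term hf r 0) hyR

/-- **The iterated derivatives of the kernel**: for a test function `f` and every `r`,
`B_f^{(r)}(x) = Σ_ρ m(ρ) P_f(ρ) (ρ-1/2)^r e^{(ρ-1/2)x}`. [folklore] -/
theorem stub_definitize_iteratedDeriv_expSum {f : ℝ → ℂ} (hf : IsWeilTest f) :
    ∀ r : ℕ, iteratedDeriv r (WeilConverse.expSum f) = fun x : ℝ =>
      ∑' ρ : ZetaZeros.riemannZetaNontrivialZeros,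
        (riemannZetaZeroOrder (ρ : ℂ) : ℂ) * WeilConverse.pairCoeff f ρ * ((ρ : ℂ) - 1 / 2) ^ r *
          cexp (((ρ : ℂ) - 1 / 2) * x)
  | 0 => by
    rw [iteratedDeriv_zero]
    funext x
    rw [WeilConverse.expSum]
    exact tsum_congr fun ρ => by rw [pow_zero, mul_one]
  | r + 1 => by
    rw [iteratedDeriv_succ, stub_definitize_iteratedDeriv_expSum hf r]
    funext y
    exact (stub_definitize_hasDerivAt_series hf r y).deriv

/-- **The kernel is smooth**: `B_f ∈ C^∞(ℝ)` for a test function `f`. [folklore] -/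
theorem stub_definitize_contDiff_expSum {f : ℝ → ℂ} (hf : IsWeilTest f) :
    ContDiff ℝ ((⊤ : ℕ∞) : WithTop ℕ∞) (WeilConverse.expSum f) := by
  refine contDiff_of_differentiable_iteratedDeriv fun m _ => ?_
  rw [stub_definitize_iteratedDeriv_expSum hf m]
  exact fun y => (stub_definitize_hasDerivAt_series hf m y).differentiableAt

/-! ### Landing anchor -/

/-- **Landing anchor of this auxiliary file** (registered sub-goal `stub_definitize_aux1` of item
stmt-RiemannHypothesis-2064, stub `stub_definitize`): the orbit formula
`Q(Σ_k c_k g(· - x_k)) = Σ_{k,l} c_k c̄_l B_g(x_k - x_l)`, binder-free restatement of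
`stub_definitize_weilQuadratic_sum_translate`. [folklore] -/
theorem stub_definitize_aux1 : ∀ {g : ℝ → ℂ}, IsWeilTest g → ∀ {n : ℕ} (x : Fin n → ℝ)
    (c : Fin n → ℂ), weilQuadratic (fun t => ∑ k, c k * g (t - x k)) =
      ∑ k, ∑ l, c k * conj (c l) * WeilConverse.expSum g (x k - x l) :=
  fun hg _ x c => stub_definitize_weilQuadratic_sum_translate hg x c

end Summit.RiemannHypothesis.RiemannHypothesis.Theorems.RuelleBandCofiniteCriticalLine

end
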